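import Mathlib
import Literature.MathematicalPhysics.QuantumFieldTheory.Balaban1983to89.B9Thm311Data
import Literature.MathematicalPhysics.QuantumFieldTheory.Balaban1983to89.B9Eq323Ker
import Literature.MathematicalPhysics.QuantumFieldTheory.Balaban1983to89.B9Eq319Onto

/-! # `Balaban1983to89.B9Thm311Lattice` — B9 Theorem 3.11 "obvious for the first three operators" on a CONCRETE
finite lattice system: every hypothesis of `B9Thm311Data.exists_data_of_ingredients` discharged, kernel-checked

CITATION HEADER.  Paper sub-cell `b2b-balaban-b09` (gen 6, journal claim SHARPEN T06.1 Thm 3.11 «obvious» concrete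
finite-lattice instance pass 12 ∕ C-B9-33-LATTICE, cell pub-balaban; v1.1 = gen-7 DOCFIX G-pv03-11 ∕ G-pv03-13: docstring
only, every declaration byte-identical to v1 p181322) on T. Balaban, *Propagators for lattice gauge
theories in a background field*, Commun. Math. Phys. 99 (1985) 389–434 [`Balaban1985BackgroundPropagators`] (= B9),
pp. 390–394, 416 [PDF 2–6, 28] (renders `b2b-balaban-ref1/pages/1985-cmp99-background-propagators/…-p002…-p006-x2.png`,
`…-p028-x2.png` read as images this session and in passes 9–11).

WHAT IS PRINTED (verbatim, the items typed here).
* p. 390–391, (3.3): *"(D^η_{U₀}A)(b) = η^{−1}(R(U₀(b))A(b₊) − A(b₋)), … or (D^η_{U₀,μ}A)(x) = (D^η_{U₀}A)(x, x + ηe_μ)"*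
  (we write λ for the printed A — as the paper does from (3.17) on — and ⟨x, x′⟩ for the printed bond (x, x′); v1.1
  per GAPS G-pv03-11); p. 390: *"R(U)X = UXU^{−1}"*.
* p. 393, (3.19): *"(Q′_j(U)λ)(y) = Σ_{x∈B^j(y)} L^{−jd}R(U(Γ^{(j)}_{y,x}))λ(x)"*; p. 394, (3.22)–(3.25): *"Δ^η_U = D^η\*_U D^η_U
  (3.23)"*, *"Let us introduce the operator Δ′_a = Δ′_a(U) = (Δ^η_U + Q′\*aQ′)↾_{Ω₀}, where Q′\*aQ′ is defined by the same
  quadratic form as in (2.14), i.e. ⟨λ, Q′\*aQ′λ⟩ = Σ_{j=0}^{k} a_j Σ_{y∈Λ_j} (L^jη)^{d−2}∣(Q′_j(U)λ)(y)∣², (3.24)"* — which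
  we READ as: Q′\* acts as the adjoint of Q′ for the corresponding (L^jη)-weighted scalar products, typed below as
  `LinearMap.adjoint` on the unweighted ℓ² (DIVERGENCE D-b09.24 (i); this reading stood inside quotation marks in v1 and
  is not a printed sentence — v1.1 per GAPS G-pv03-13) —, *"we consider the operator Δ′_a with Dirichlet boundary
  conditions on ∂Ω₀ … Its inverse is denoted by G′, or G′(U)."*; p. 394,
  (3.20)–(3.21): *"where R = R(U) is an orthogonal projection in the Hilbert space L²(Ω₀,𝔤) onto the subspace … N(Q′) =
  {λ : Q′λ = 0}. (3.21)"*; pp. 394–395: *"Using the Lagrange multipliers method the minimum of (3.22) can be found by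
  the same calculations as in [4], (2.15)–(2.17), and we obtain the formula Rf = (I − G′Q′\*(Q′G′²Q′\*)^{−1}Q′G′)f,
  (3.25) where G′ = G′(U) = (Δ′_a)^{−1}. We do not know yet if the operators in the above formula are well defined.
  Assuming some regularity of the configuration U it can be easily shown that the operator Δ′_a is positive. This
  implies positivity of the operators G′, Q′G′²Q′\*, hence the existence of the operator R."* ((3.20)–(3.25) typed
  in `B9Eq325Proj`, pass 6).
* p. 416, Theorem 3.11: *"the operators Δ′_a, G′, (Q′G′²Q′\*)^{−1}, Δ_a, G are positive definite. This is obvious for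
  the first three operators"*.

WHY THIS FILE.  Passes 9–11 reduced the clause to named hypotheses over ABSTRACT real inner-product spaces E, F
(`B9Thm311Data.exists_data_of_ingredients`: hΔ, hadj, hA, hΔnn, hApos, hker, hqs) and proved the two lattice facts
(`B9Eq323Ker.hker_323`, `B9Eq319Onto.avgQLin_surjective` + `injective_of_adjoint_of_surjective`) over bare function
spaces X → V.  The recorded remaining step (GAPS C-B9-32 (iii)) was TYPING: realise L²(sites, 𝔤) and L²(centres, 𝔤) as
Mathlib inner-product spaces carrying these operators.  This file does it with Mathlib's ℓ² structure `PiLp 2`: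
for FINITE site / centre / bond sets and a finite-dimensional real inner-product fibre V,
  E := PiLp 2 (X → V),  F := PiLp 2 (Y → V),  Q′ := `qL` (the (3.19) operator `avgQLin` transported to PiLp),
  Q′\* := `LinearMap.adjoint qL` ((3.24): the adjoint for the ℓ² products), D := `DL` (f ↦ (√c_b · (D_U f)(b))_b, the
  weighted covariant derivative (3.3) into PiLp 2 (bonds → V)), Δ := `lapL` = D†D ((3.23)), A := `AL` = diag(a_c) —
and DISCHARGES all seven hypotheses, so that the conclusions of pass 9 hold outright: Δ′_a = Δ + Q′\*AQ′ > 0, its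
inverse G′ > 0 exists and is symmetric, Q′G′²Q′\* > 0, C = (Q′G′²Q′\*)^{−1} > 0 exists and is symmetric, and (G′, C)
satisfy the (3.25) `Data` (hence R = the orthogonal projection as typed in pass 6) — i.e. the p. 395 sentences *"it
can be easily shown that the operator Δ′_a is positive. This implies positivity of the operators G′, Q′G′²Q′\*, hence
the existence of the operator R"* hold at this typing for EVERY background field U (NO "regularity of the
configuration U" is needed: transports only need to be injective linear maps, which conjugations R(U) are) and every
block/contour system with the printed structural properties, with no smallness condition.  [folklore]; value = kernel-checked
bookkeeping closing the typing gap of passes 5–11, NOT summit progress.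

TYPING / DICTIONARY.  ℓ² weights: the printed products (3.24) carry lattice weights η^d, (L^jη)^d; here the unweighted
`PiLp 2` product is used (weights can be absorbed into c_b, a_c and the block weights w; recorded in DIVERGENCE
D-b09.24, not asserted to be Balaban's normalisation).  `IsBlockSystem bonds w B Γ y` bundles the eight structural
facts used by passes 10–11 (contours are bond chains from the centre ending at the site; block weight sums ≠ 0; blocks
cover; y ∈ B(y); trivial contour at the centre; centre weight ≠ 0; centres of distinct blocks not in each other's
block).  NOT here: that Balaban's cubes B^j(y) and contours (52)–(53) of [5] satisfy `IsBlockSystem` (a statement about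
a concrete Z^d model — B7BlockGeometry types the cubes; the contour system is not typed in the tree), any bound.
Cell records: GAPS C-B9-33, DIVERGENCE D-b09.24. -/

namespace Literature.MathematicalPhysics.QuantumFieldTheory.Balaban1983to89.B9Thm311Lattice

open B9Eq325Proj B9Thm311Data B9Eq323Ker B9Eq319Onto
open scoped BigOperators InnerProductSpace

section Lattice

variable {X : Type*} {Y : Type*} {V : Type*} [NormedAddCommGroup V] [InnerProductSpace ℝ V]

/-! ## §1  The operators on the ℓ² spaces -/

/-- The printed structural facts about blocks, contours and weights used by passes 10–11, bundled.
[cite: Balaban1985BackgroundPropagators, (3.18)-(3.19) p.393; Balaban1985Averaging, (2) p.17, (9) p.18] -/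
structure IsBlockSystem (bonds : Finset (X × X)) (w : Y → X → ℝ) (B : Y → Finset X) (Γ : Y → X → List X)
    (y : Y → X) : Prop where
  chain : ∀ c, ∀ x ∈ B c, List.IsChain (fun a a' => (a, a') ∈ bonds) (y c :: Γ c x)
  last : ∀ c, ∀ x ∈ B c, (y c :: Γ c x).getLast (List.cons_ne_nil _ _) = x
  sum_ne : ∀ c, ∑ x ∈ B c, w c x ≠ 0
  cover : ∀ x : X, ∃ c, x ∈ B c
  centre_mem : ∀ c, y c ∈ B c
  centre_path : ∀ c, Γ c (y c) = []
  centre_wt : ∀ c, w c (y c) ≠ 0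
  disj : ∀ c c', c ≠ c' → y c' ∉ B c

/-- Q′ of (3.19) as a linear map between the ℓ² spaces E = PiLp 2 (X → V), F = PiLp 2 (Y → V).
[cite: Balaban1985BackgroundPropagators, (3.19) p.393] -/
noncomputable def qL (τ : X → X → V →ₗ[ℝ] V) (w : Y → X → ℝ) (B : Y → Finset X) (Γ : Y → X → List X)
    (y : Y → X) : PiLp 2 (fun _ : X => V) →ₗ[ℝ] PiLp 2 (fun _ : Y => V) :=
  (WithLp.linearEquiv 2 ℝ (Y → V)).symm.toLinearMap ∘ₗ avgQLin τ w B Γ y ∘ₗ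
    (WithLp.linearEquiv 2 ℝ (X → V)).toLinearMap

/-- Pointwise: (Q′f)(c) = Σ_{x∈B(c)} w(c,x)·R(U(Γ_{c,x}))f(x). [cite: Balaban1985BackgroundPropagators, (3.19) p.393] -/
theorem qL_apply (τ : X → X → V →ₗ[ℝ] V) (w : Y → X → ℝ) (B : Y → Finset X) (Γ : Y → X → List X)
    (y : Y → X) (f : PiLp 2 (fun _ : X => V)) (c : Y) :
    qL τ w B Γ y f c = avgQ τ w B Γ (WithLp.ofLp f) y c := rfl

/-- Q′ is onto (pass 11 transported). [cite: Balaban1985BackgroundPropagators, (3.19) p.393] -/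
theorem qL_surjective (τ : X → X → V →ₗ[ℝ] V) {bonds : Finset (X × X)} {w : Y → X → ℝ} {B : Y → Finset X}
    {Γ : Y → X → List X} {y : Y → X} (hS : IsBlockSystem bonds w B Γ y) :
    Function.Surjective (qL τ w B Γ y) := by
  classical
  intro ω
  obtain ⟨l, hl⟩ := avgQLin_surjective τ w B Γ y hS.centre_mem hS.centre_path hS.centre_wt hS.disj (WithLp.ofLp ω)
  refine ⟨WithLp.toLp 2 l, ?_⟩
  apply PiLp.ext
  intro c
  rw [qL_apply, WithLp.ofLp_toLp, ← avgQLin_apply, hl]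

/-- `covD` is additive in λ. [folklore] -/
theorem covD_add (τ : X → X → V →ₗ[ℝ] V) (l l' : X → V) (x x' : X) :
    covD τ (l + l') x x' = covD τ l x x' + covD τ l' x x' := by
  simp only [covD, Pi.add_apply, map_add]
  abel

/-- `covD` is homogeneous in λ. [folklore] -/
theorem covD_smul (τ : X → X → V →ₗ[ℝ] V) (r : ℝ) (l : X → V) (x x' : X) :
    covD τ (r • l) x x' = r • covD τ l x x' := by
  simp only [covD, Pi.smul_apply, map_smul, smul_sub]

/-- The weighted covariant derivative (3.3) as a map on bare functions: (Df)(b) = √c_b · (R(U(b))f(b₊) − f(b₋)).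
[cite: Balaban1985BackgroundPropagators, (3.3) p.390-391] -/
noncomputable def Dfun (τ : X → X → V →ₗ[ℝ] V) (bonds : Finset (X × X)) (cb : X × X → ℝ) :
    (X → V) →ₗ[ℝ] (↥bonds → V) where
  toFun l b := Real.sqrt (cb b.1) • covD τ l b.1.1 b.1.2
  map_add' l l' := by
    funext b
    simp only [covD_add, smul_add, Pi.add_apply]
  map_smul' r l := by
    funext b
    simp only [covD_smul, Pi.smul_apply, RingHom.id_apply, smul_comm r]

/-- D of (3.3)/(3.23) between the ℓ² spaces E = PiLp 2 (X → V) and PiLp 2 (bonds → V).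
[cite: Balaban1985BackgroundPropagators, (3.3) p.390, (3.23) p.394] -/
noncomputable def DL (τ : X → X → V →ₗ[ℝ] V) (bonds : Finset (X × X)) (cb : X × X → ℝ) :
    PiLp 2 (fun _ : X => V) →ₗ[ℝ] PiLp 2 (fun _ : ↥bonds => V) :=
  (WithLp.linearEquiv 2 ℝ (↥bonds → V)).symm.toLinearMap ∘ₗ Dfun τ bonds cb ∘ₗ
    (WithLp.linearEquiv 2 ℝ (X → V)).toLinearMap

/-- Pointwise form of `DL`. [folklore] -/
theorem DL_apply (τ : X → X → V →ₗ[ℝ] V) (bonds : Finset (X × X)) (cb : X × X → ℝ)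
    (f : PiLp 2 (fun _ : X => V)) (b : ↥bonds) :
    DL τ bonds cb f b = Real.sqrt (cb b.1) • covD τ (WithLp.ofLp f) b.1.1 b.1.2 := rfl

/-- ‖Df‖² = Σ_b c_b ‖(D_U f)(b)‖² — the quadratic form of (3.23). [cite: Balaban1985BackgroundPropagators, (3.23) p.394] -/
theorem norm_DL_sq (τ : X → X → V →ₗ[ℝ] V) (bonds : Finset (X × X)) (cb : X × X → ℝ)
    (hcb : ∀ b ∈ bonds, 0 ≤ cb b) (f : PiLp 2 (fun _ : X => V)) :
    ‖DL τ bonds cb f‖ ^ 2 = ∑ b ∈ bonds, cb b * ‖covD τ (WithLp.ofLp f) b.1 b.2‖ ^ 2 := by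
  rw [PiLp.norm_sq_eq_of_L2]
  rw [← Finset.sum_coe_sort bonds (fun b => cb b * ‖covD τ (WithLp.ofLp f) b.1 b.2‖ ^ 2)]
  refine Finset.sum_congr rfl fun b _ => ?_
  rw [DL_apply, norm_smul, mul_pow, Real.norm_eq_abs, sq_abs, Real.sq_sqrt (hcb b.1 b.2)]

/-- The multiplication operator A = diag(a_c) on F = PiLp 2 (Y → V) (the a_j L^{…} weights of (3.22)/(3.24)).
[cite: Balaban1985BackgroundPropagators, (3.22)-(3.24) p.394] -/
noncomputable def AL (a : Y → ℝ) : PiLp 2 (fun _ : Y => V) →ₗ[ℝ] PiLp 2 (fun _ : Y => V) where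
  toFun φ := WithLp.toLp 2 (fun c => a c • φ c)
  map_add' φ ψ := by
    apply PiLp.ext; intro c
    simp only [PiLp.add_apply, smul_add]
  map_smul' r φ := by
    apply PiLp.ext; intro c
    simp only [PiLp.smul_apply, RingHom.id_apply, smul_comm r]

/-- Pointwise form of `AL`. [folklore] -/
theorem AL_apply (a : Y → ℝ) (φ : PiLp 2 (fun _ : Y => V)) (c : Y) : AL a φ c = a c • φ c := rfl

section CentreSpace

variable [Fintype Y]

/-- hA: A is symmetric. [folklore] -/
theorem AL_symm (a : Y → ℝ) (φ ψ : PiLp 2 (fun _ : Y => V)) : ⟪AL a φ, ψ⟫_ℝ = ⟪φ, AL a ψ⟫_ℝ := by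
  rw [PiLp.inner_apply, PiLp.inner_apply]
  refine Finset.sum_congr rfl fun c _ => ?_
  rw [AL_apply, AL_apply, real_inner_smul_left, real_inner_smul_right]

/-- ⟨φ, Aφ⟩ = Σ_c a_c‖φ(c)‖². [folklore] -/
theorem inner_AL_self (a : Y → ℝ) (φ : PiLp 2 (fun _ : Y => V)) :
    ⟪φ, AL a φ⟫_ℝ = ∑ c, a c * ‖φ c‖ ^ 2 := by
  rw [PiLp.inner_apply]
  refine Finset.sum_congr rfl fun c _ => ?_
  rw [AL_apply, real_inner_smul_right, real_inner_self_eq_norm_sq]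

/-- hApos: a_c > 0 for all c ⇒ A positive definite. [cite: Balaban1985BackgroundPropagators, Thm 3.11 p.416] -/
theorem AL_posDef (a : Y → ℝ) (ha : ∀ c, 0 < a c) : PosDef (AL (V := V) a) := by
  intro φ hφ
  rw [inner_AL_self]
  have hex : ∃ c, φ c ≠ 0 := by
    by_contra h
    push Not at h
    exact hφ (PiLp.ext h)
  obtain ⟨c₀, hc₀⟩ := hex
  apply Finset.sum_pos' (fun c _ => mul_nonneg (ha c).le (sq_nonneg _))
  exact ⟨c₀, Finset.mem_univ _, mul_pos (ha c₀) (by positivity)⟩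

end CentreSpace

section SiteSpace

variable [Fintype X] [FiniteDimensional ℝ V]

/-- Δ^η_U (restricted, Dirichlet) = D†D on E, (3.23). [cite: Balaban1985BackgroundPropagators, (3.23) p.394] -/
noncomputable def lapL (τ : X → X → V →ₗ[ℝ] V) (bonds : Finset (X × X)) (cb : X × X → ℝ) :
    PiLp 2 (fun _ : X => V) →ₗ[ℝ] PiLp 2 (fun _ : X => V) :=
  LinearMap.adjoint (DL τ bonds cb) ∘ₗ DL τ bonds cb

/-- ⟨Δf, g⟩ = ⟨Df, Dg⟩. [cite: Balaban1985BackgroundPropagators, (3.23) p.394] -/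
theorem inner_lapL_left (τ : X → X → V →ₗ[ℝ] V) (bonds : Finset (X × X)) (cb : X × X → ℝ)
    (f g : PiLp 2 (fun _ : X => V)) :
    ⟪lapL τ bonds cb f, g⟫_ℝ = ⟪DL τ bonds cb f, DL τ bonds cb g⟫_ℝ := by
  rw [lapL, LinearMap.comp_apply, LinearMap.adjoint_inner_left]

/-- ⟨f, Δg⟩ = ⟨Df, Dg⟩. [cite: Balaban1985BackgroundPropagators, (3.23) p.394] -/
theorem inner_lapL_right (τ : X → X → V →ₗ[ℝ] V) (bonds : Finset (X × X)) (cb : X × X → ℝ)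
    (f g : PiLp 2 (fun _ : X => V)) :
    ⟪f, lapL τ bonds cb g⟫_ℝ = ⟪DL τ bonds cb f, DL τ bonds cb g⟫_ℝ := by
  rw [lapL, LinearMap.comp_apply, LinearMap.adjoint_inner_right]

/-- hΔ: Δ is symmetric. [cite: Balaban1985BackgroundPropagators, (3.23) p.394] -/
theorem lapL_symm (τ : X → X → V →ₗ[ℝ] V) (bonds : Finset (X × X)) (cb : X × X → ℝ)
    (f g : PiLp 2 (fun _ : X => V)) : ⟪lapL τ bonds cb f, g⟫_ℝ = ⟪f, lapL τ bonds cb g⟫_ℝ := by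
  rw [inner_lapL_left, inner_lapL_right]

/-- ⟨f, Δf⟩ = Σ_b c_b‖(D_U f)(b)‖² — the printed identification of the quadratic form (3.23).
[cite: Balaban1985BackgroundPropagators, (3.23) p.394] -/
theorem inner_lapL_self (τ : X → X → V →ₗ[ℝ] V) (bonds : Finset (X × X)) (cb : X × X → ℝ)
    (hcb : ∀ b ∈ bonds, 0 ≤ cb b) (f : PiLp 2 (fun _ : X => V)) :
    ⟪f, lapL τ bonds cb f⟫_ℝ = ∑ b ∈ bonds, cb b * ‖covD τ (WithLp.ofLp f) b.1 b.2‖ ^ 2 := by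
  rw [inner_lapL_right, real_inner_self_eq_norm_sq, norm_DL_sq τ bonds cb hcb]

/-- hΔnn: Δ ≥ 0. [cite: Balaban1985BackgroundPropagators, (3.23) p.394] -/
theorem lapL_nonneg (τ : X → X → V →ₗ[ℝ] V) (bonds : Finset (X × X)) (cb : X × X → ℝ)
    (f : PiLp 2 (fun _ : X => V)) : 0 ≤ ⟪f, lapL τ bonds cb f⟫_ℝ := by
  rw [inner_lapL_right]
  exact real_inner_self_nonneg

/-- hker: ⟨f, Δf⟩ = 0 and Q′f = 0 ⇒ f = 0 (pass 10, `hker_323`, transported to the ℓ² spaces).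
[cite: Balaban1985BackgroundPropagators, (3.23) p.394, Thm 3.11 p.416] -/
theorem lapL_qL_kernel (τ : X → X → V →ₗ[ℝ] V) (hinj : ∀ x x' : X, Function.Injective (τ x x'))
    {bonds : Finset (X × X)} (cb : X × X → ℝ) (hcb : ∀ b ∈ bonds, 0 < cb b) {w : Y → X → ℝ}
    {B : Y → Finset X} {Γ : Y → X → List X} {y : Y → X} (hS : IsBlockSystem bonds w B Γ y)
    (f : PiLp 2 (fun _ : X => V)) (hD : ⟪f, lapL τ bonds cb f⟫_ℝ = 0) (hQ : qL τ w B Γ y f = 0) : f = 0 := by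
  rw [inner_lapL_self τ bonds cb (fun b hb => (hcb b hb).le)] at hD
  have hQ' : ∀ c : Y, avgQ τ w B Γ (WithLp.ofLp f) y c = 0 := by
    intro c
    rw [← qL_apply, hQ]
    rfl
  have h0 : WithLp.ofLp f = 0 :=
    hker_323 τ hinj bonds cb hcb w B Γ y hS.chain hS.last hS.sum_ne hS.cover (WithLp.ofLp f) hD hQ'
  exact (WithLp.ofLp_eq_zero 2).mp h0

end SiteSpace

section Both

variable [Fintype X] [Fintype Y] [FiniteDimensional ℝ V]

/-- hadj: Q′\* := the ℓ²-adjoint of Q′ ((3.24)). [cite: Balaban1985BackgroundPropagators, (3.24) p.394] -/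
theorem qL_adjoint_pair (τ : X → X → V →ₗ[ℝ] V) (w : Y → X → ℝ) (B : Y → Finset X) (Γ : Y → X → List X)
    (y : Y → X) (f : PiLp 2 (fun _ : X => V)) (φ : PiLp 2 (fun _ : Y => V)) :
    ⟪qL τ w B Γ y f, φ⟫_ℝ = ⟪f, LinearMap.adjoint (qL τ w B Γ y) φ⟫_ℝ :=
  (LinearMap.adjoint_inner_right _ f φ).symm

/-- hqs: Q′\* is injective (pass 11: Q′ onto ⇒ adjoint injective). [cite: Balaban1984PropagatorsI, p.25] -/
theorem adjoint_qL_injective (τ : X → X → V →ₗ[ℝ] V) {bonds : Finset (X × X)} {w : Y → X → ℝ}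
    {B : Y → Finset X} {Γ : Y → X → List X} {y : Y → X} (hS : IsBlockSystem bonds w B Γ y) :
    Function.Injective (LinearMap.adjoint (qL τ w B Γ y)) :=
  injective_of_adjoint_of_surjective (qL τ w B Γ y) _ (qL_adjoint_pair τ w B Γ y) (qL_surjective τ hS)

/-! ## §2  Theorem 3.11, "obvious for the first three operators", on the lattice system -/

/-- ⟨f, Δ′_a f⟩ = Σ_b c_b‖(D_U f)(b)‖² + Σ_c a_c‖(Q′f)(c)‖² — `lapA` IS the operator of the quadratic form
(3.22)/(3.24) (Δ^η_U plus the averaging term). [cite: Balaban1985BackgroundPropagators, (3.22)-(3.24) p.394] -/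
theorem inner_lapA_lattice (τ : X → X → V →ₗ[ℝ] V) (bonds : Finset (X × X)) (cb : X × X → ℝ)
    (hcb : ∀ b ∈ bonds, 0 ≤ cb b) (w : Y → X → ℝ) (B : Y → Finset X) (Γ : Y → X → List X) (y : Y → X)
    (a : Y → ℝ) (f : PiLp 2 (fun _ : X => V)) :
    ⟪f, lapA (lapL τ bonds cb) (qL τ w B Γ y) (LinearMap.adjoint (qL τ w B Γ y)) (AL a) f⟫_ℝ =
      (∑ b ∈ bonds, cb b * ‖covD τ (WithLp.ofLp f) b.1 b.2‖ ^ 2) +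
        ∑ c, a c * ‖avgQ τ w B Γ (WithLp.ofLp f) y c‖ ^ 2 := by
  rw [inner_lapA _ _ _ _ (qL_adjoint_pair τ w B Γ y), inner_lapL_self τ bonds cb hcb, inner_AL_self]
  rfl

/-- **Δ′_a > 0** on the lattice system. [cite: Balaban1985BackgroundPropagators, Thm 3.11 p.416] -/
theorem lapA_lattice_posDef (τ : X → X → V →ₗ[ℝ] V) (hinj : ∀ x x' : X, Function.Injective (τ x x'))
    {bonds : Finset (X × X)} (cb : X × X → ℝ) (hcb : ∀ b ∈ bonds, 0 < cb b) {w : Y → X → ℝ}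
    {B : Y → Finset X} {Γ : Y → X → List X} {y : Y → X} (hS : IsBlockSystem bonds w B Γ y) (a : Y → ℝ)
    (ha : ∀ c, 0 < a c) :
    PosDef (lapA (lapL τ bonds cb) (qL τ w B Γ y) (LinearMap.adjoint (qL τ w B Γ y)) (AL a)) :=
  lapA_posDef_of _ _ _ _ (qL_adjoint_pair τ w B Γ y) (lapL_nonneg τ bonds cb) (AL_posDef a ha)
    (fun f hD hQ => lapL_qL_kernel τ hinj cb hcb hS f hD hQ)

/-- **Theorem 3.11, first three operators, on every finite lattice system**: there exist G′ = (Δ′_a)^{−1} and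
C = (Q′G′²Q′\*)^{−1}, both positive definite and symmetric, with Δ′_a positive definite, satisfying the (3.25) `Data`
of pass 6 — for every background field (injective transports), positive bond weights, positive a_c, and every block
system with the printed structural properties. [cite: Balaban1985BackgroundPropagators, Thm 3.11 p.416, (3.25) p.394] -/
theorem obvious_311_lattice (τ : X → X → V →ₗ[ℝ] V) (hinj : ∀ x x' : X, Function.Injective (τ x x'))
    {bonds : Finset (X × X)} (cb : X × X → ℝ) (hcb : ∀ b ∈ bonds, 0 < cb b) {w : Y → X → ℝ}
    {B : Y → Finset X} {Γ : Y → X → List X} {y : Y → X} (hS : IsBlockSystem bonds w B Γ y) (a : Y → ℝ)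
    (ha : ∀ c, 0 < a c) :
    ∃ (g : PiLp 2 (fun _ : X => V) →ₗ[ℝ] PiLp 2 (fun _ : X => V))
      (c : PiLp 2 (fun _ : Y => V) →ₗ[ℝ] PiLp 2 (fun _ : Y => V)),
      B9Eq325Proj.Data (lapL τ bonds cb) (qL τ w B Γ y) (LinearMap.adjoint (qL τ w B Γ y)) (AL a) g c ∧
        PosDef (lapA (lapL τ bonds cb) (qL τ w B Γ y) (LinearMap.adjoint (qL τ w B Γ y)) (AL a)) ∧
        PosDef g ∧ PosDef c ∧ (∀ f f', ⟪g f, f'⟫_ℝ = ⟪f, g f'⟫_ℝ) ∧ (∀ φ ψ, ⟪c φ, ψ⟫_ℝ = ⟪φ, c ψ⟫_ℝ) :=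
  exists_data_of_ingredients (lapL_symm τ bonds cb) (qL_adjoint_pair τ w B Γ y) (AL_symm a)
    (lapL_nonneg τ bonds cb) (AL_posDef a ha) (fun f hD hQ => lapL_qL_kernel τ hinj cb hcb hS f hD hQ)
    (adjoint_qL_injective τ hS)

/-- And the (3.25) projection statement of pass 6 holds on the lattice system: for the G′, C above, R′ of (3.25) is
the orthogonal projection onto the kernel N = ker Q′ ∩ … as typed in `B9Eq325Proj` (`lapKer`).
[cite: Balaban1985BackgroundPropagators, (3.25) p.394] -/
theorem proj_325_lattice (τ : X → X → V →ₗ[ℝ] V) (hinj : ∀ x x' : X, Function.Injective (τ x x'))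
    {bonds : Finset (X × X)} (cb : X × X → ℝ) (hcb : ∀ b ∈ bonds, 0 < cb b) {w : Y → X → ℝ}
    {B : Y → Finset X} {Γ : Y → X → List X} {y : Y → X} (hS : IsBlockSystem bonds w B Γ y) (a : Y → ℝ)
    (ha : ∀ c, 0 < a c) :
    ∃ (g : PiLp 2 (fun _ : X => V) →ₗ[ℝ] PiLp 2 (fun _ : X => V))
      (c : PiLp 2 (fun _ : Y => V) →ₗ[ℝ] PiLp 2 (fun _ : Y => V)),
      B9Eq325Proj.Data (lapL τ bonds cb) (qL τ w B Γ y) (LinearMap.adjoint (qL τ w B Γ y)) (AL a) g c ∧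
        ∀ f, (lapKer (lapL τ bonds cb) (qL τ w B Γ y)).starProjection f =
          R325 (qL τ w B Γ y) (LinearMap.adjoint (qL τ w B Γ y)) g c f := by
  obtain ⟨g, c, hdata, -, -, -, -, -⟩ := obvious_311_lattice τ hinj cb hcb hS a ha
  exact ⟨g, c, hdata, fun f => proj_of_any_data hdata f⟩

end Both

end Lattice

end Literature.MathematicalPhysics.QuantumFieldTheory.Balaban1983to89.B9Thm311Lattice
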